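import Mathlib.MeasureTheory.Measure.Haar.Unique
import Literature.Probability.LatticeModels.GinibreModel
import HarnessLib

/-!
# Ginibre's inequality for generalised plane rotators / compact abelian lattice models

J. Ginibre, *General formulation of Griffiths' inequalities*, Comm. Math. Phys. 16 (1970)
310–328, proves Griffiths' inequalities `⟨fg⟩ − ⟨f⟩⟨g⟩ ≥ 0` for `f, g` in the cone generated
by the functions `cos(m·φ)` of a family of plane rotators with ferromagnetic many-body
couplings `−H = ∑_A J_A cos(m_A·φ)`, `J_A ≥ 0`; the standard corollary is that every
`⟨cos(m·φ)⟩` is non-decreasing in every coupling `J_A`. This is the inequality behind the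
existence of the free-boundary infinite-volume limit and the comparison of boundary conditions
in `U(1)` lattice gauge theory (Fröhlich–Spencer 1982; Garban–Sepúlveda 2023 Prop. 2.11), where
the rotators sit on edges and the `cos(m_A·φ)` are plaquette and Wilson-loop cosines.

We prove the monotone form in the generality of a **compact second-countable abelian group `Ω` in
which every element is a square** (e.g. any torus `U(1)^E`), with interaction "cosines"
`Re χₐ` for continuous unitary characters `χₐ : Ω →ₜ* U(1)` and a Haar probability measure `μ`
(the algebraic part is `GinibreModel.lean`, the kernel toolkit `GinibrePositiveKernels.lean`):

* `measurePreserving_dupHom`: the duplication map `(φ, ψ) ↦ (φψ, φψ⁻¹)` preserves `μ ⊗ μ`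
  (a continuous surjective endomorphism of the compact group `Ω × Ω`; Mathlib's
  `MonoidHom.measurePreserving`), hence `integral_comp_dupHom`;
* `integral_ginibreIntegrand_nonneg`: `∫∫ 4 Im χ₀ Im χ₀ sinh B exp C d(μ ⊗ μ) ≥ 0`
  (truncations are positive kernels; dominated convergence);
* **`ginibreExpect_reChar_mono`**: `0 ≤ J ≤ J'` (pointwise) implies
  `ginibreExpect μ χ J (Re χ₀) ≤ ginibreExpect μ χ J' (Re χ₀)` for every continuous character
  `χ₀` — via `integral_sub_mul_sub_mul` (Fubini), the change of variables, `ginibre_key` and the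
  positivity.

## Scope

Only the monotone corollary for observables `Re χ₀` and Hamiltonians linear in the `Re χₐ` is
proved (what the `U(1)` lattice-gauge comparison
`Literature.MathematicalPhysics.QuantumFieldTheory.GinibreU1TorusGeFreeBoxD4` needs); Ginibre's
full cone statement and Griffiths' first inequality are not formalised here. Mathlib has no
Griffiths/Ginibre inequalities; the tree's `GKSInequalities.lean` treats `±1` spins only.
-/

noncomputable section

open MeasureTheory Filter Finset
open scoped Topology BigOperators

namespace Literature.Probability.LatticeModels

/-! ### Haar measure: the duplication map preserves `μ ⊗ μ`; positivity; the inequality -/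

section Haar

variable {Ω : Type*} [CommGroup Ω] [TopologicalSpace Ω] [IsTopologicalGroup Ω] [CompactSpace Ω]
  [SecondCountableTopology Ω] [MeasurableSpace Ω] [BorelSpace Ω] {ι : Type*} [Fintype ι]

/-- **The duplication map preserves `μ ⊗ μ`** for a Haar measure `μ` on a compact 2-divisible
abelian group: it is a continuous surjective endomorphism of the compact group `Ω × Ω`, and the
image of a Haar measure under such a map is the Haar measure of the same mass (Mathlib
`MonoidHom.measurePreserving`) — the Jacobian-free form of Ginibre's `dθ dθ' = dφ dψ`.
[folklore] -/
theorem measurePreserving_dupHom (μ : Measure Ω) [μ.IsHaarMeasure]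
    (h2 : Function.Surjective fun ψ : Ω => ψ * ψ) :
    MeasurePreserving (dupHom : Ω × Ω → Ω × Ω) (μ.prod μ) (μ.prod μ) :=
  MonoidHom.measurePreserving continuous_dupHom (dupHom_surjective h2) rfl

/-- Change of variables under the duplication map for continuous integrands:
`∫∫ g(φψ, φψ⁻¹) dμ(φ) dμ(ψ) = ∫∫ g(θ, θ') dμ(θ) dμ(θ')`. [folklore] -/
theorem integral_comp_dupHom (μ : Measure Ω) [μ.IsHaarMeasure]
    (h2 : Function.Surjective fun ψ : Ω => ψ * ψ) {g : Ω × Ω → ℝ} (hg : Continuous g) :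
    ∫ p, g (dupHom p) ∂(μ.prod μ) = ∫ p, g p ∂(μ.prod μ) := by
  have h := measurePreserving_dupHom μ h2
  calc ∫ p, g (dupHom p) ∂(μ.prod μ) = ∫ p, g p ∂((μ.prod μ).map dupHom) :=
        (integral_map h.measurable.aemeasurable hg.aestronglyMeasurable).symm
    _ = ∫ p, g p ∂(μ.prod μ) := by rw [h.map_eq]

omit [IsTopologicalGroup Ω] in
/-- **Positivity of the Ginibre integral**: `∫∫ 4 Im χ₀ Im χ₀ · sinh B · exp C d(μ ⊗ μ) ≥ 0` for
`δ, γ ≥ 0` and any finite measure `μ` — limit (dominated convergence, uniform bound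
`4 sinh(∑δ) exp(∑γ)`) of the integrals of the truncations, each non-negative as the integral
of a positive kernel. [cite: Ginibre1970, main theorem with the plane-rotator example cos(m·φ)] -/
theorem integral_ginibreIntegrand_nonneg (μ : Measure Ω) [IsFiniteMeasure μ]
    (χ : ι → Ω →ₜ* Circle) (χ₀ : Ω →ₜ* Circle) {δ γ : ι → ℝ} (hδ : ∀ a, 0 ≤ δ a)
    (hγ : ∀ a, 0 ≤ γ a) : 0 ≤ ∫ p, ginibreIntegrand χ χ₀ δ γ p ∂(μ.prod μ) := by
  have hlim : Tendsto (fun N => ∫ p, ginibreTrunc χ χ₀ δ γ N p ∂(μ.prod μ)) atTop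
      (𝓝 (∫ p, ginibreIntegrand χ χ₀ δ γ p ∂(μ.prod μ))) := by
    refine tendsto_integral_of_dominated_convergence
      (fun _ => 4 * (Real.sinh (∑ a, δ a) * Real.exp (∑ a, γ a))) ?_ (integrable_const _) ?_ ?_
    · exact fun N => (isPosKernel_ginibreTrunc χ χ₀ hδ hγ N).continuous.aestronglyMeasurable
    · exact fun N => ae_of_all _ fun p => by
        rw [Real.norm_eq_abs]; exact abs_ginibreTrunc_le χ χ₀ hδ hγ N p
    · exact ae_of_all _ fun p => tendsto_ginibreTrunc χ χ₀ δ γ p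
  exact ge_of_tendsto' hlim fun N => (isPosKernel_ginibreTrunc χ χ₀ hδ hγ N).integral_nonneg μ

/-- **Ginibre's inequality (Griffiths' second inequality for generalised plane rotators, in
monotone form).** Let `Ω` be a compact second-countable abelian group in which every element is a
square (e.g. a torus `U(1)^E`), `μ` a Haar probability measure, `χₐ, χ₀` continuous unitary
characters and `0 ≤ Jₐ ≤ J'ₐ`. Then the Gibbs expectation of `Re χ₀` for the weights
`exp(∑ Jₐ Re χₐ)` is non-decreasing: `⟨Re χ₀⟩_J ≤ ⟨Re χ₀⟩_{J'}`. For `Ω = U(1)^E`,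
`χ(θ) = e^{i m·θ}`: `⟨cos(m·θ)⟩` increases with each ferromagnetic coupling `J_A` of
`−H = ∑ J_A cos(m_A·θ)` (Ginibre 1970, general Griffiths inequalities with the plane-rotator
example; here in the derivative-free form `2 Z_J Z_{J'} (⟨f⟩_{J'} − ⟨f⟩_J) =
∫∫ (f−f')(e^{K}−e^{K'}) e^{H+H'} ≥ 0`, `K = ∑ (J'−J)ₐ Re χₐ`). [cite: Ginibre1970, main theorem with the plane-rotator example cos(m·φ)] -/
theorem ginibreExpect_reChar_mono (μ : Measure Ω) [μ.IsHaarMeasure] [IsProbabilityMeasure μ]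
    (h2 : Function.Surjective fun ψ : Ω => ψ * ψ) (χ : ι → Ω →ₜ* Circle) (χ₀ : Ω →ₜ* Circle)
    {J J' : ι → ℝ} (hJ : ∀ a, 0 ≤ J a) (hJJ' : ∀ a, J a ≤ J' a) :
    ginibreExpect μ χ J (reChar χ₀) ≤ ginibreExpect μ χ J' (reChar χ₀) := by
  set δ : ι → ℝ := fun a => J' a - J a with hδdef
  have hδ : ∀ a, 0 ≤ δ a := fun a => sub_nonneg.2 (hJJ' a)
  have hγ : ∀ a, 0 ≤ δ a + 2 * J a := fun a => by have := hδ a; have := hJ a; positivity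
  have hw' : ∀ θ, ginibreWeight χ J' θ = ginibreWeight χ J θ * ginibreWeight χ δ θ := fun θ => by
    rw [← ginibreWeight_add]
    congr 1
    funext a
    simp [hδdef]
  have hfc := continuous_reChar χ₀
  have hwc := continuous_ginibreWeight χ J
  have hδc := continuous_ginibreWeight χ δ
  have hZ : 0 < ∫ θ, ginibreWeight χ J θ ∂μ :=
    integral_exp_pos (integrable_of_continuous_compactSpace μ hwc)
  have hZ' : 0 < ∫ θ, ginibreWeight χ J θ * ginibreWeight χ δ θ ∂μ := by
    have : (fun θ => ginibreWeight χ J θ * ginibreWeight χ δ θ) = ginibreWeight χ (J + δ) := by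
      funext θ; rw [ginibreWeight_add]
    rw [this]
    exact integral_exp_pos (integrable_of_continuous_compactSpace μ (continuous_ginibreWeight χ _))
  unfold ginibreExpect
  simp_rw [hw']
  rw [div_le_div_iff₀ hZ hZ']
  -- the duplicated difference is the integral of the (non-negative) Ginibre integrand
  have hdup := integral_sub_mul_sub_mul μ hfc hδc hwc
  have hcont : Continuous fun p : Ω × Ω =>
      (reChar χ₀ p.1 - reChar χ₀ p.2) * (ginibreWeight χ δ p.1 - ginibreWeight χ δ p.2) *
        (ginibreWeight χ J p.1 * ginibreWeight χ J p.2) := by fun_prop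
  have hcv : ∫ p : Ω × Ω, (reChar χ₀ (p.1 * p.2) - reChar χ₀ (p.1 * p.2⁻¹)) *
        (ginibreWeight χ δ (p.1 * p.2) - ginibreWeight χ δ (p.1 * p.2⁻¹)) *
        (ginibreWeight χ J (p.1 * p.2) * ginibreWeight χ J (p.1 * p.2⁻¹)) ∂(μ.prod μ) =
      ∫ p : Ω × Ω, (reChar χ₀ p.1 - reChar χ₀ p.2) *
        (ginibreWeight χ δ p.1 - ginibreWeight χ δ p.2) *
        (ginibreWeight χ J p.1 * ginibreWeight χ J p.2) ∂(μ.prod μ) := by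
    simpa only [dupHom_apply] using integral_comp_dupHom μ h2 hcont
  have hI : ∫ p : Ω × Ω, (reChar χ₀ (p.1 * p.2) - reChar χ₀ (p.1 * p.2⁻¹)) *
        (ginibreWeight χ δ (p.1 * p.2) - ginibreWeight χ δ (p.1 * p.2⁻¹)) *
        (ginibreWeight χ J (p.1 * p.2) * ginibreWeight χ J (p.1 * p.2⁻¹)) ∂(μ.prod μ) =
      ∫ p, ginibreIntegrand χ χ₀ δ (fun a => δ a + 2 * J a) p ∂(μ.prod μ) :=
    integral_congr_ae (ae_of_all _ fun p => ginibre_key χ χ₀ J δ p.1 p.2)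
  have hpos := integral_ginibreIntegrand_nonneg μ χ χ₀ hδ hγ
  rw [← hI, hcv, hdup] at hpos
  nlinarith [hpos]

end Haar

end Literature.Probability.LatticeModels
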